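import Summits.QuantumFields.YangMills.Theorems.BalabanUVNodesN15KingModelEffectiveLaplacianContinuumLimit

/-!
# BalabanUVNodes ∕ N15 — THE KING-MODEL RUNG (PART Ϡ-j): KING's THEOREM 3.3 (3.6) AND (4.34)(ii) FOR THE CONTINUUM PARTNERS — THE CLOSED-FORM LIMITS `C^{(∞)}`
# AND `Δ^{(∞)}` HAVE UNIFORM EXPONENTIAL DECAY: `|C^{(∞)}(b, b′)| ≤ (2∕γ_m)e^{−κ_M|b−b′|}`, `|Δ^{(∞)}(b, b′)| ≤ C_U e^{−κ_U|b−b′|}`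
# (Track A, DAG node N15 = NE2; FAN-OUT v1.1 §N15 s3 «KING-MODEL RUNG … NE2's analogue DECIDED in the model»)

HONEST FRAMING.  Count-neutral (cell `pub-ymgap`, seat `pub-ymgap-dag-n15-e` g32; `--supports stmt-QuantumFields-27366 --as helper` = K3⁸
`SpineGivenEndpointR13SepCoPHV`).  TEMPLATE LITERATURE: C. King, *The U(1) Higgs model. I. The continuum limit*, Commun. Math. Phys. **102** (1986) 649–677
[King1986] — KING's OWN `A = 0` MODEL: Theorem 3.3 (3.6) p. 655 «|C^{(k)}(x, y)|, |G_k(x, y)| ≦ C exp[−δ|x − y|]» and (4.34)(ii) p. 674 «Δ^{(k)} has uniform exponential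
decay», in the tree as `King1986.Torus.effLaplacian_inv_decay` (seat n18-b∕pub-balaban: `|(Δ^{(k)})⁻¹(b,b′)| ≤ (2∕γ_m)e^{−κ_M|b−b′|_T}`, uniform in `k ≥ 1`, the
volume) and `effLaplacian_entry_le_unif` (`|Δ_{a₁,N}(b,b′)| ≤ C_U e^{−κ_U|b−b′|_T}` for `a_min ≤ a₁ ≤ a`, every `N`), and parts Ϡ-e∕Ϡ-g's closed-form limits
`C^{(∞)} = blockCovLim`, `Δ^{(∞)} = effLaplacianLim`.  NOT Bałaban's objects; NOT a node discharge (N15 is booked through n15-a's knit, untouched here); nothing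
continuum-Yang–Mills ∕ ℝ⁴ ∕ OS ∕ mass-gap ∕ Clay.  0 `sorry`; standard axioms; 0 `def`.

THE MATHEMATICS.  Uniform-in-`K` kernel bounds pass to the `K → ∞` limit (`le_of_tendsto`): the decay estimates of Thm 3.3∕(4.34) for `(Δ^{(K)})⁻¹` and `Δ^{(K)}`
(King's `a_K ∈ [a_min, a]`, `a_min = a(1 − L⁻²) = a_∞`) hold VERBATIM for the explicit continuum partners, with the same constants.

WHAT THIS FILE PROVES (kernel).  `aInf_eq_aminL` (`a_∞` IS the tree's `a_min`), ★★ **`abs_blockCovLim_le_decay`** (`|C^{(∞)}(b,b′)| ≤ (2∕γ_m)·e^{−κ_M·tdistT(b,b′)}`),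
★★ **`abs_effLaplacianLim_le_decay`** (`|Δ^{(∞)}(b,b′)| ≤ C_U·e^{−κ_U·tdistT(b,b′)}`), `abs_blockCovLim_le` (`≤ 2∕γ_m`), on EVERY unit torus (`L` odd `≥ 2`, `a, m² > 0`).

HONEST SCOPE.  King's `A = 0` model on a finite unit torus; constants `γ_m = gamM`, `κ_M = kapM`, `C_U = CDelU`, `κ_U = kapU` of the tree, not optimised.  N15 untouched;
counts unmoved.  Locators: [King1986] Thm 3.3 (3.6) p.655, (4.33)–(4.34) p.674, (2.13)–(2.14) p.653.
-/

noncomputable section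

open Filter Topology

namespace Summit.QuantumFields.YangMills.BalabanUVNodes.N15KingModelRung

open Literature.MathematicalPhysics.QuantumFieldTheory.Balaban1983to89.B5Prop11Plancherel (Tor)
open Literature.MathematicalPhysics.QuantumFieldTheory.King1986 (aK)
open Literature.MathematicalPhysics.QuantumFieldTheory.King1986.Torus

variable {d : ℕ}

section Decay

variable (L : ℕ) (M : Fin (d + 1) → ℕ) [hM : ∀ μ, NeZero (M μ)]

omit hM in
/-- `a_∞ = a(1 − L⁻²)` IS the tree's `a_min` of the uniform run `a_K ∈ [a_min, a]`. [cite: King1986, (2.13) p.653] -/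
theorem aInf_eq_aminL (a : ℝ) : aInf a (L : ℝ) = aminL a L := rfl

/-- ★★ **THEOREM 3.3 (3.6) FOR THE CONTINUUM BLOCK COVARIANCE**: `|C^{(∞)}(b, b′)| ≤ (2∕γ_m)·e^{−κ_M·tdistT(b, b′)}` on every unit torus (`L` odd `≥ 2`, `a, m² > 0`) —
the tree's uniform bound for `(Δ^{(K)})⁻¹` passed to the closed-form limit. [cite: King1986, Thm 3.3 (3.6) p.655, (4.33)–(4.34) p.674] -/
theorem abs_blockCovLim_le_decay (hLodd : Odd L) (hL : 2 ≤ L) {a m2 : ℝ} (ha : 0 < a) (hm : 0 < m2) (b b' : Tor M) :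
    |blockCovLim L M a m2 b b'| ≤ 2 / gamM a m2 L * Real.exp (-(kapM (d + 1) a m2 L * tdistT M b b')) := by
  haveI : NeZero L := ⟨by omega⟩
  have hlim := (tendsto_blockCov L M hLodd hL ha hm b b').abs
  refine le_of_tendsto hlim ?_
  filter_upwards [eventually_ge_atTop 1] with K hK
  have h := effLaplacian_inv_decay (d := d + 1) ha hm hL hK M b b'
  unfold blockCov
  exact h

/-- `|C^{(∞)}(b, b′)| ≤ 2∕γ_m`. [cite: King1986, Thm 3.3 (3.6) p.655] -/
theorem abs_blockCovLim_le (hLodd : Odd L) (hL : 2 ≤ L) {a m2 : ℝ} (ha : 0 < a) (hm : 0 < m2) (b b' : Tor M) :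
    |blockCovLim L M a m2 b b'| ≤ 2 / gamM a m2 L := by
  have h := abs_blockCovLim_le_decay L M hLodd hL ha hm b b'
  have hγ := gamM_pos ha hm hL
  have hκ := (kapM_pos_le (d := d + 1) ha hm hL).1
  have hd := tdistT_nonneg M b b'
  have hexp : Real.exp (-(kapM (d + 1) a m2 L * tdistT M b b')) ≤ 1 := Real.exp_le_one_iff.mpr (by nlinarith)
  calc |blockCovLim L M a m2 b b'| ≤ 2 / gamM a m2 L * Real.exp (-(kapM (d + 1) a m2 L * tdistT M b b')) := h
    _ ≤ 2 / gamM a m2 L * 1 := mul_le_mul_of_nonneg_left hexp (by positivity)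
    _ = 2 / gamM a m2 L := mul_one _

/-- ★★ **(4.34)(ii) FOR THE CONTINUUM EFFECTIVE LAPLACIAN**: `|Δ^{(∞)}(b, b′)| ≤ C_U·e^{−κ_U·tdistT(b, b′)}` on every unit torus (`L` odd `≥ 2`, `a, m² > 0`; `C_U = CDelU
(d+1) a a_min`, `κ_U = kapU (d+1) a a_min`) — the tree's bound, uniform over King's run `a_K ∈ [a_min, a]`, passed to the closed-form limit.
[cite: King1986, (4.34) p.674, Thm 3.3 (3.6) p.655] -/
theorem abs_effLaplacianLim_le_decay (hLodd : Odd L) (hL : 2 ≤ L) {a m2 : ℝ} (ha : 0 < a) (hm : 0 < m2) (b b' : Tor M) :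
    |effLaplacianLim L M a m2 b b'| ≤ CDelU (d + 1) a (aminL a L) * Real.exp (-(kapU (d + 1) a (aminL a L) * tdistT M b b')) := by
  haveI : NeZero L := ⟨by omega⟩
  have hlim := (tendsto_effLaplacian L M hLodd hL ha hm b b').abs
  refine le_of_tendsto hlim ?_
  filter_upwards [eventually_ge_atTop 1] with K hK
  obtain ⟨h1, h2⟩ := aminL_le_aK ha hL hK
  exact effLaplacian_entry_le_unif (d := d + 1) ha (aminL_pos ha hL) h1 h2 hm (L ^ K) M b b'

end Decay

end Summit.QuantumFields.YangMills.BalabanUVNodes.N15KingModelRung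

end
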